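import Mathlib
import HarnessLib

/-!
# Functional-equation modulus on the line `Re w = −½` (K1 support, file 5/6)

`‖ζ(−½+it)‖² = (¼+t²)/(4π²) · ‖ζ(3/2+it)‖²` via `Λ(1−s) = Λ(s)`, `Γℝ`, `Γ(s+1) = sΓ(s)` and conjugation
symmetry (no trigonometric identities).  This is the modulus of the functional equation that the profile
Parseval step of K1 (`CoprofileIsometry`, stmt-RiemannHypothesis-21612) consumes.

Ported verbatim (split into tree-sized files, docstrings added, originally `ZetaReflectHalfLine.lean`, merged into v5) from rh-idea-5 g0's desk file
`pub/ideators/rh-idea-5/ProfileBernoulli.lean` v5 (sha16 4e6baba130239d85, lean check rc 0), in support of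
item stmt-RiemannHypothesis-21612 `CoprofileIsometry` (K1 of route ScrewLemmaKCoprofile; shared with
ScrewLemmaKExtremalRay).
RH-free real/complex analysis: this is NOT a proof of RH and nothing here bears on the truth of RH.
-/

noncomputable section

set_option linter.dupNamespace false

namespace Summit.RiemannHypothesis.RiemannHypothesis.Theorems.IntegerScrew.ZetaReflect

open Complex

/-- `ζ(−½+it) = Γℝ(s)·ζ(s)/Γℝ(1−s)` with `s = 3/2 − it`. [folklore] -/
theorem zeta_neg_half_line_eq (t : ℝ) :
    riemannZeta (-(1 / 2 : ℂ) + t * I)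
      = Gammaℝ (3 / 2 - t * I) * riemannZeta (3 / 2 - t * I) / Gammaℝ (1 - (3 / 2 - t * I)) := by
  set s : ℂ := 3 / 2 - t * I with hs_def
  have hs0 : s ≠ 0 := by
    intro h
    have := congrArg Complex.re h
    simp [hs_def] at this
  have h1s : 1 - s = -(1 / 2 : ℂ) + t * I := by rw [hs_def]; ring
  have h1s0 : 1 - s ≠ 0 := by
    rw [h1s]; intro h
    have := congrArg Complex.re h
    norm_num at this
  have hG1s : Gammaℝ (1 - s) ≠ 0 := by
    rw [Ne, Gammaℝ_eq_zero_iff, not_exists]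
    intro n h
    have h' := congrArg Complex.re h
    rw [h1s] at h'
    simp at h'
    have : (2 : ℝ) * n = 1 / 2 := by linarith
    rcases Nat.eq_zero_or_pos n with hn | hn
    · subst hn; norm_num at this
    · have : (1 : ℝ) ≤ n := by exact_mod_cast hn
      linarith
  have hFE : riemannZeta (1 - s) * Gammaℝ (1 - s) = Gammaℝ s * riemannZeta s := by
    rw [riemannZeta_def_of_ne_zero h1s0, completedRiemannZeta_one_sub, riemannZeta_def_of_ne_zero hs0]
    have hGs : Gammaℝ s ≠ 0 := Gammaℝ_ne_zero_of_re_pos (by simp [hs_def])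
    field_simp
  rw [← h1s, eq_div_iff hG1s, hFE]

/-- `‖Γℝ(3/2 − it)‖ = π^{−3/4}·‖−¼ − (t/2)i‖·‖Γ(−¼ + (t/2)i)‖`. [folklore] -/
theorem norm_Gammaℝ_threeHalves (t : ℝ) :
    ‖Gammaℝ (3 / 2 - t * I)‖
      = Real.pi ^ (-(3 / 4 : ℝ)) * ‖(-(1 / 4 : ℂ) - t / 2 * I)‖ * ‖Complex.Gamma (-(1 / 4 : ℂ) + t / 2 * I)‖ := by
  rw [Gammaℝ_def, norm_mul]
  have h1 : ‖(Real.pi : ℂ) ^ (-(3 / 2 - t * I) / 2)‖ = Real.pi ^ (-(3 / 4 : ℝ)) := by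
    rw [Complex.norm_cpow_eq_rpow_re_of_pos Real.pi_pos]
    congr 1
    simp; norm_num
  have h2 : Complex.Gamma ((3 / 2 - t * I) / 2)
      = (-(1 / 4 : ℂ) - t / 2 * I) * Complex.Gamma (-(1 / 4 : ℂ) - t / 2 * I) := by
    have hz : (-(1 / 4 : ℂ) - t / 2 * I) ≠ 0 := by
      intro h
      have := congrArg Complex.re h
      norm_num at this
    have := Complex.Gamma_add_one _ hz
    rw [← this]
    congr 1
    ring
  have h3 : ‖Complex.Gamma (-(1 / 4 : ℂ) - t / 2 * I)‖ = ‖Complex.Gamma (-(1 / 4 : ℂ) + t / 2 * I)‖ := by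
    have hc : (-(1 / 4 : ℂ) - t / 2 * I) = (starRingEnd ℂ) (-(1 / 4 : ℂ) + t / 2 * I) := by
      apply Complex.ext <;> simp [map_ofNat]
    rw [hc, Complex.Gamma_conj, Complex.norm_conj]
  rw [h1, h2, norm_mul, h3, mul_assoc]

/-- `‖Γℝ(1 − (3/2 − it))‖ = π^{1/4}·‖Γ(−¼ + (t/2)i)‖`. [folklore] -/
theorem norm_Gammaℝ_one_sub_threeHalves (t : ℝ) :
    ‖Gammaℝ (1 - (3 / 2 - t * I))‖ = Real.pi ^ ((1 / 4 : ℝ)) * ‖Complex.Gamma (-(1 / 4 : ℂ) + t / 2 * I)‖ := by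
  rw [Gammaℝ_def, norm_mul]
  have h1 : ‖(Real.pi : ℂ) ^ (-(1 - (3 / 2 - t * I)) / 2)‖ = Real.pi ^ ((1 / 4 : ℝ)) := by
    rw [Complex.norm_cpow_eq_rpow_re_of_pos Real.pi_pos]
    congr 1
    simp; norm_num
  have h2 : (1 - (3 / 2 - t * I)) / 2 = -(1 / 4 : ℂ) + t / 2 * I := by ring
  rw [h1, h2]

/-- `‖ζ(3/2 − it)‖ = ‖ζ(3/2 + it)‖` (conjugation symmetry). [folklore] -/
theorem norm_zeta_threeHalves_conj (t : ℝ) :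
    ‖riemannZeta (3 / 2 - t * I)‖ = ‖riemannZeta (3 / 2 + t * I)‖ := by
  have hc : (3 / 2 - t * I : ℂ) = (starRingEnd ℂ) (3 / 2 + t * I) := by
    apply Complex.ext <;> simp [map_ofNat]
  rw [hc, riemannZeta_conj, Complex.norm_conj]

/-- FUNCTIONAL-EQUATION MODULUS on `Re w = −½`:
`‖ζ(−½ + it)‖² = (¼ + t²)/(4π²) · ‖ζ(3/2 + it)‖²`. [folklore] -/
theorem norm_sq_zeta_neg_half_line (t : ℝ) :
    ‖riemannZeta (-(1 / 2 : ℂ) + t * I)‖ ^ 2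
      = (1 / 4 + t ^ 2) / (4 * Real.pi ^ 2) * ‖riemannZeta (3 / 2 + t * I)‖ ^ 2 := by
  rw [zeta_neg_half_line_eq, norm_div, norm_mul, norm_Gammaℝ_threeHalves, norm_Gammaℝ_one_sub_threeHalves,
    norm_zeta_threeHalves_conj]
  set q : ℝ := Real.pi ^ ((1 / 4 : ℝ)) with hq
  set G : ℝ := ‖Complex.Gamma (-(1 / 4 : ℂ) + t / 2 * I)‖ with hG
  set Z : ℝ := ‖riemannZeta (3 / 2 + t * I)‖ with hZ
  have hqpos : 0 < q := Real.rpow_pos_of_pos Real.pi_pos _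
  have hq4 : q ^ 4 = Real.pi := by
    rw [hq, ← Real.rpow_natCast, ← Real.rpow_mul Real.pi_pos.le]; norm_num
  have ha : Real.pi ^ (-(3 / 4 : ℝ)) = (q ^ 3)⁻¹ := by
    rw [hq, ← Real.rpow_natCast, ← Real.rpow_mul Real.pi_pos.le, ← Real.rpow_neg Real.pi_pos.le]; norm_num
  have hGpos : 0 < G := by
    rw [hG, norm_pos_iff]
    apply Complex.Gamma_ne_zero
    intro m h
    have := congrArg Complex.re h
    simp at this
    have : (m : ℝ) = 1 / 4 := by linarith
    rcases Nat.eq_zero_or_pos m with hm | hm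
    · subst hm; norm_num at this
    · have : (1 : ℝ) ≤ m := by exact_mod_cast hm
      linarith
  have hA : ‖(-(1 / 4 : ℂ) - t / 2 * I)‖ ^ 2 = 1 / 16 + t ^ 2 / 4 := by
    have : (-(1 / 4 : ℂ) - t / 2 * I) = ((-(1 / 4) : ℝ) : ℂ) + ((-(t / 2) : ℝ) : ℂ) * I := by
      push_cast; ring
    rw [this, Complex.sq_norm, Complex.normSq_add_mul_I]; ring
  rw [ha, ← hq4]
  rw [div_pow, mul_pow, mul_pow, mul_pow, hA]
  field_simp
  ring

end Summit.RiemannHypothesis.RiemannHypothesis.Theorems.IntegerScrew.ZetaReflect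

end
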